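import Summits.QuantumFields.BalabanUV.Beta.GAN24.ExchangeE2E2Channel
import Summits.QuantumFields.BalabanUV.Beta.GAN24.ExitFaceSlotStaircase

/-!
# `BalabanUV.Beta.GAN24.ExchangeESectorStaircase` — binder row G-an2-4 ∕ (CONV-C), W-slot (α-0), ROW (C) AT LEVELS `j ≥ 1`, (W4)∕(W6)∕(W7) of the (γ) hand's memo
# `HOME/b2b-balaban-gan24-formalise-leaf-06/g52/C-LEVELS-GE1.md` IN ONE STROKE: **THE E-SECTOR EE WORD OF ROW (C) AT LEVEL `j+1` IS A QUADRATIC EXPRESSION IN THE VALUE HESSIAN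
# `E2_{j+1}` AND THE DRESSED STEP KERNEL `X̃♮_{j+1}` ALONE —
# `word = |box|·c₀σ_{j+1}²·K_E²·Σ_{x∈box} Σ_a [−½·Σ'_y ⌊y_μ∕Lc⌋χ_α(y)·E2_{j+1}(y,x)_{αa}] · [Σ'_z Σ_b X̃♮_{j+1}(x,z)_{ab}·½·Σ'_{s′} E2_{j+1}(z,s′)_{bβ}·⌊s′_ν∕Lc⌋χ_β(s′)]`**
# (`K_E = (sf·sm)⁻¹·sf⁻²·cE`, `c₀σ_{j+1} = (Lc·sm·sf)·((Lc^{j+2})^{d+2})⁻¹`, `χ_α(y) = [y_α % Lc = Lc−1]`; every `j`, in-block root, all units, any amplitude `cE`, any `cΛ`)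
# (G-an2-4 CRUX TEAM (2), seat `b2b-balaban-gan24-formalise-leaf-06` = the (γ) hand, gen 53; journal INTENT I-leaf06-g53-2)

NOT IN PRINT; OUR BOOKKEEPING ([folklore] BY NAME: gen 52's `ExchangeWordCellPairing.exchangeWord_eq_cellPairing` (the reduced EE word = `|box|·c₀σ²` × the cell pairing of the two
two-face currents, generic table), `ExchangeE2E2Channel.locStencil_sectorTable ∕ sectorTable_translate ∕ faceface_unitS_smul_fst`, `ExchangeE2E2ChannelTools.faceface_unitS_smul` (units),
and gen 53's `ExitFaceSlotStaircase.faceface_e3OfK_eq_stair ∕ _fst` (both currents of the table `V_j = e3OfK Lc G_j (SrecAt … j)` are `E2_{j+1}`-images of «staircase × exit face»);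
0 `def`, 0 cited fact, 0 `def … : Prop`, 0 sorry).
HONEST FRAMING (cell contract, verbatim): «discharging `BetaPertH` makes Bałaban's UV stability UNCONDITIONAL — a real constructive-QFT result; it is NOT the continuum
limit and NOT the Clay problem.»  HONEST DEPENDENCY (verbatim): «continuum YM on T⁴ ⇐ BetaPertH ∧ nine spine estimates (0/9 proved); BetaPertH ⇐ (D1) ∧ (D4) ∧ CAP+tail;
G-an2-4 gates asym, D1 and NE2/3/4.»

WHY.  Gen 52's `ExchangeE2E2Channel.exchangeWord_sector_eq` wrote the same word with each current split as `Lc⁻¹τ ± (2Lc)⁻¹e` and left the three `τ` pairings open ((W4)∕(W7)).  The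
staircase letter (`ExitFaceSlotStaircase`) values the whole current at once, so no split is needed: every table of Bałaban's drops out of the E-sector exchange word, which is now a
bilinear form in `E2_{j+1}`-images of the explicit profiles `p_{νβ}(s′) := ⌊s′_ν∕Lc⌋·χ_β(s′)` through `X̃♮_{j+1}`.  ENGINE (weight 0; E-leaf06-g53-1 = kit j201825, D = 2, levels 0 and
1): the word equals `κ·Σ_sym a_Lᵀ E2 a_R` to 10 digits and carries road-P2's `|A∧a|²` pattern tensor (`EX(0011) : EX(0101) = −2 : 1`); the tensor structure is the antisymmetry
`E2_{j+1} p_{νβ} = −E2_{j+1} p_{βν}` (E2 kills `d(⌊·_ν∕Lc⌋·⌊·_β∕Lc⌋)`), next file.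
* §1 **`exchangeWord_sector_eq_stair`** — the statement in the title (same left side as `ExchangeE2E2Channel.exchangeWord_sector_eq`).
WHERE IT SITS: the EX side of (C)_{j+1}'s E⊗E sector, every level, in closed form; the VALUE (`wVH_{j+1}⁻¹`-telescoped `E2`-forms by L4′, p2's one scalar `u_j` per level) and the junction
with leaf-02's CT side are next.  Asserts NO value of Bałaban's tables beyond this identity; discharges NOTHING of (C) ∕ (C)sym ∕ (Q-L) ∕ «T2Shape» ∕ «T2Drift» ∕ (hW, hWall); NEVER
«G-an2-4 closed» as (CONV-C); NOT D1, NOT `BetaPertH`, NOT continuum, NOT Clay.  2026-08-23; no existing file touched.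
-/

noncomputable section

open Finset
open scoped BigOperators
open Literature.MathematicalPhysics.QuantumFieldTheory
open Literature.MathematicalPhysics.QuantumFieldTheory.Balaban1983to89
open Literature.MathematicalPhysics.QuantumFieldTheory.Balaban1983to89.Beta
open ExpKernelCalculus (Site MKer)
open OneStepResolventKernel (Fib LocStencil)
open OneStepKernelFamily (KInvStep vertexOfK)
open AffineAveraging (box toSite)
open BalabanStepJetsSucc (E2)
open Summit.QuantumFields.BalabanUV.Beta.AxialDressingRooted (coDressKBmAt one_le_of_neZero)
open Summit.QuantumFields.BalabanUV.Beta.HessKerDressedUnits (unitK unitS)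
open Summit.QuantumFields.BalabanUV.Beta.SpineRooted (e3OfK)
open Summit.QuantumFields.BalabanUV.Beta.WardLocusRecursive (SrecAt)
open Summit.QuantumFields.BalabanUV.Beta.GAN24.ExchangeE2E2ChannelTools (faceface_unitS_smul)
open Summit.QuantumFields.BalabanUV.Beta.GAN24.ExchangeWordCellPairing (exchangeWord_eq_cellPairing)
open Summit.QuantumFields.BalabanUV.Beta.GAN24.ExchangeE2E2Channel (locStencil_sectorTable sectorTable_translate faceface_unitS_smul_fst)
open Summit.QuantumFields.BalabanUV.Beta.GAN24.ExitFaceSlotStaircase (faceface_e3OfK_eq_stair faceface_e3OfK_eq_stair_fst)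

namespace Summit.QuantumFields.BalabanUV.Beta.GAN24.ExchangeESectorStaircase

variable {d : ℕ} {Lc : ℕ} [NeZero Lc] {r : Fin (d + 1) → ℕ}

/-! ## §1 The E-sector EE word, table-free -/

/-- [folklore] **THE E-SECTOR EE WORD OF ROW (C) AT LEVEL `j+1`, TABLE-FREE** (every `j`, in-block root, all units, amplitude `cE`, any `cΛ`): the reduced EE word
(vertices and middle kernel `X̃♮ = unitK sf sm G_{j+1}`, table `S_E = cE • V_j`)
`= |box|·c₀σ_{j+1}²·Σ_{x∈box} Σ_a [K_E·(−½·Σ'_y (⌊y_μ∕Lc⌋·χ_α(y))·E2_{j+1}(y,x)_{αa})] · [K_E·(½·Σ'_z Σ_b X̃♮(x,z)_{ab}·Σ'_{s′} E2_{j+1}(z,s′)_{bβ}·(⌊s′_ν∕Lc⌋·χ_β(s′)))]`. -/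
theorem exchangeWord_sector_eq_stair (hr : r ∈ box (d + 1) Lc) (sf sm cE cΛ : ℝ) (j : ℕ) (μ α ν β : Fin (d + 1)) :
    ∑ u ∈ box (d + 1) Lc, ∑' y₁ : Site (d + 1), ∑ a : Fin (d + 1),
        (∑' y : Site (d + 1), (if y α % (Lc : ℤ) = (Lc : ℤ) - 1 then (1 : ℝ) else 0) *
          vertexOfK (unitK sf sm (coDressKBmAt (toSite r) Lc (KInvStep (d := d) Lc (j + 1)))) Lc
            (unitS sf sm (fun κ u => cE • e3OfK Lc (coDressKBmAt (toSite r) Lc (KInvStep (d := d) Lc j))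
              (SrecAt d Lc (toSite r) ((Lc : ℝ) ^ (d + 1)) (-((Lc : ℝ) ^ (d + 1) * (1 / 2) * (Lc : ℝ) ^ (d + 1))) cΛ j) κ u)) μ (toSite u) y y₁ (Sum.inl α) (Sum.inl a)) *
        (∑' z : Site (d + 1), ∑ b : Fin (d + 1), unitK sf sm (coDressKBmAt (toSite r) Lc (KInvStep (d := d) Lc (j + 1))) y₁ z (Sum.inl a) (Sum.inl b) *
          (∑' u' : Site (d + 1), ∑' w : Site (d + 1), (if w β % (Lc : ℤ) = (Lc : ℤ) - 1 then (1 : ℝ) else 0) *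
            vertexOfK (unitK sf sm (coDressKBmAt (toSite r) Lc (KInvStep (d := d) Lc (j + 1)))) Lc
              (unitS sf sm (fun κ u => cE • e3OfK Lc (coDressKBmAt (toSite r) Lc (KInvStep (d := d) Lc j))
                (SrecAt d Lc (toSite r) ((Lc : ℝ) ^ (d + 1)) (-((Lc : ℝ) ^ (d + 1) * (1 / 2) * (Lc : ℝ) ^ (d + 1))) cΛ j) κ u)) ν u' z w (Sum.inl b) (Sum.inl β))) =
      ((box (d + 1) Lc).card : ℝ) * (((Lc : ℝ) * (sm * sf)) * ((((Lc ^ (j + 1 + 1) : ℕ) : ℝ)) ^ (d + 1 + 1))⁻¹) ^ 2 *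
        ∑ x ∈ box (d + 1) Lc, ∑ a : Fin (d + 1),
          (((sf * sm)⁻¹ * (sf⁻¹ * sf⁻¹) * cE) *
            (-(1 / 2 : ℝ) * ∑' y : Site (d + 1), ((((y μ / (Lc : ℤ) : ℤ) : ℝ)) * (if y α % (Lc : ℤ) = (Lc : ℤ) - 1 then (1 : ℝ) else 0)) *
              E2 d Lc (j + 1) y (toSite x) (Sum.inl α) (Sum.inl a))) *
          (((sf * sm)⁻¹ * (sf⁻¹ * sf⁻¹) * cE) *
            ((1 / 2 : ℝ) * ∑' z : Site (d + 1), ∑ b : Fin (d + 1), unitK sf sm (coDressKBmAt (toSite r) Lc (KInvStep (d := d) Lc (j + 1))) (toSite x) z (Sum.inl a) (Sum.inl b) *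
              ∑' s' : Site (d + 1), E2 d Lc (j + 1) z s' (Sum.inl b) (Sum.inl β) *
                ((((s' ν / (Lc : ℤ) : ℤ) : ℝ)) * (if s' β % (Lc : ℤ) = (Lc : ℤ) - 1 then (1 : ℝ) else 0)))) := by
  have hLc : 1 ≤ Lc := one_le_of_neZero Lc
  obtain ⟨Cs, δs, hδs, hS⟩ := locStencil_sectorTable (d := d) hr cE cΛ j
  rw [exchangeWord_eq_cellPairing (μ := μ) (α := α) (ν := ν) (β := β) hr hS hδs (fun κ u v => sectorTable_translate (r := r) cE cΛ j κ u v) sf sm (j + 1)]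
  refine congrArg (fun t : ℝ => ((box (d + 1) Lc).card : ℝ) * (((Lc : ℝ) * (sm * sf)) * ((((Lc ^ (j + 1 + 1) : ℕ) : ℝ)) ^ (d + 1 + 1))⁻¹) ^ 2 * t)
    (Finset.sum_congr rfl fun x _ => Finset.sum_congr rfl fun a _ => ?_)
  -- left current: units out, then the staircase letter (first-leg form)
  have hL : (∑' y : Site (d + 1), (if y α % (Lc : ℤ) = (Lc : ℤ) - 1 then (1 : ℝ) else 0) *
      ∑' t : Site (d + 1), (if t μ % (Lc : ℤ) = (Lc : ℤ) - 1 then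
        unitS sf sm (fun κ u => cE • e3OfK Lc (coDressKBmAt (toSite r) Lc (KInvStep (d := d) Lc j))
          (SrecAt d Lc (toSite r) ((Lc : ℝ) ^ (d + 1)) (-((Lc : ℝ) ^ (d + 1) * (1 / 2) * (Lc : ℝ) ^ (d + 1))) cΛ j) κ u) μ t y (toSite x) (Sum.inl α) (Sum.inl a)
        else 0)) =
      ((sf * sm)⁻¹ * (sf⁻¹ * sf⁻¹) * cE) *
        (-(1 / 2 : ℝ) * ∑' y : Site (d + 1), ((((y μ / (Lc : ℤ) : ℤ) : ℝ)) * (if y α % (Lc : ℤ) = (Lc : ℤ) - 1 then (1 : ℝ) else 0)) *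
          E2 d Lc (j + 1) y (toSite x) (Sum.inl α) (Sum.inl a)) := by
    rw [faceface_unitS_smul_fst sf sm cE _ μ (fun t : Site (d + 1) => t μ % (Lc : ℤ) = (Lc : ℤ) - 1)
      (fun y : Site (d + 1) => (if y α % (Lc : ℤ) = (Lc : ℤ) - 1 then (1 : ℝ) else 0)) (toSite x) α a, faceface_e3OfK_eq_stair_fst hr cΛ j μ α (toSite x) a]
  -- right current: pointwise in `(z, b)`, units out, then the staircase letter
  have hR : ∀ (z : Site (d + 1)) (b : Fin (d + 1)), (∑' w : Site (d + 1), (if w β % (Lc : ℤ) = (Lc : ℤ) - 1 then (1 : ℝ) else 0) *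
      ∑' t : Site (d + 1), (if t ν % (Lc : ℤ) = (Lc : ℤ) - 1 then
        unitS sf sm (fun κ u => cE • e3OfK Lc (coDressKBmAt (toSite r) Lc (KInvStep (d := d) Lc j))
          (SrecAt d Lc (toSite r) ((Lc : ℝ) ^ (d + 1)) (-((Lc : ℝ) ^ (d + 1) * (1 / 2) * (Lc : ℝ) ^ (d + 1))) cΛ j) κ u) ν t z w (Sum.inl b) (Sum.inl β)
        else 0)) =
      ((sf * sm)⁻¹ * (sf⁻¹ * sf⁻¹) * cE) *
        ((1 / 2 : ℝ) * ∑' s' : Site (d + 1), E2 d Lc (j + 1) z s' (Sum.inl b) (Sum.inl β) *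
          ((((s' ν / (Lc : ℤ) : ℤ) : ℝ)) * (if s' β % (Lc : ℤ) = (Lc : ℤ) - 1 then (1 : ℝ) else 0))) := by
    intro z b
    rw [faceface_unitS_smul sf sm cE _ ν (fun t : Site (d + 1) => t ν % (Lc : ℤ) = (Lc : ℤ) - 1)
      (fun w : Site (d + 1) => (if w β % (Lc : ℤ) = (Lc : ℤ) - 1 then (1 : ℝ) else 0)) z b β, faceface_e3OfK_eq_stair hr cΛ j ν β z b]
  have hR' : (∑' z : Site (d + 1), ∑ b : Fin (d + 1), unitK sf sm (coDressKBmAt (toSite r) Lc (KInvStep (d := d) Lc (j + 1))) (toSite x) z (Sum.inl a) (Sum.inl b) *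
      (∑' w : Site (d + 1), (if w β % (Lc : ℤ) = (Lc : ℤ) - 1 then (1 : ℝ) else 0) *
        ∑' t : Site (d + 1), (if t ν % (Lc : ℤ) = (Lc : ℤ) - 1 then
          unitS sf sm (fun κ u => cE • e3OfK Lc (coDressKBmAt (toSite r) Lc (KInvStep (d := d) Lc j))
            (SrecAt d Lc (toSite r) ((Lc : ℝ) ^ (d + 1)) (-((Lc : ℝ) ^ (d + 1) * (1 / 2) * (Lc : ℝ) ^ (d + 1))) cΛ j) κ u) ν t z w (Sum.inl b) (Sum.inl β)
          else 0))) =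
      ((sf * sm)⁻¹ * (sf⁻¹ * sf⁻¹) * cE) *
        ((1 / 2 : ℝ) * ∑' z : Site (d + 1), ∑ b : Fin (d + 1), unitK sf sm (coDressKBmAt (toSite r) Lc (KInvStep (d := d) Lc (j + 1))) (toSite x) z (Sum.inl a) (Sum.inl b) *
          ∑' s' : Site (d + 1), E2 d Lc (j + 1) z s' (Sum.inl b) (Sum.inl β) *
            ((((s' ν / (Lc : ℤ) : ℤ) : ℝ)) * (if s' β % (Lc : ℤ) = (Lc : ℤ) - 1 then (1 : ℝ) else 0))) := by
    rw [← mul_assoc, ← tsum_mul_left]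
    refine tsum_congr fun z => ?_
    rw [Finset.mul_sum]
    refine Finset.sum_congr rfl fun b _ => ?_
    rw [hR z b]
    ring
  rw [hL, hR']

end Summit.QuantumFields.BalabanUV.Beta.GAN24.ExchangeESectorStaircase

end
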